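import Summits.CriticalPhenomena.PercolationContinuityZ3.Theorems.PercLowPointHalfSpaceQuantitativeBGNWallDefs
import Summits.CriticalPhenomena.PercolationContinuityZ3.Theorems.PercLowPointHalfSpaceQuantitativeBGNWallBootstrapPrep
import Summits.CriticalPhenomena.PercolationContinuityZ3.Theorems.PercLowPointHalfSpaceQuantitativeBGNWallTwoGhostBasics
import Summits.CriticalPhenomena.PercolationContinuityZ3.Theorems.PercLowPointHalfSpaceQuantitativeBGNWallTwoGhostMTP
import Mathlib.MeasureTheory.Integral.Lebesgue.Markov
import HarnessLib

/-!
# `QuantitativeBGN` (stmt-CriticalPhenomena-0913), line `longrange-wall-ghost-bootstrap` — thin-foot slab volume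

Stub `stub_thinFootSlabVolume` of the lead-c5 skeleton of the line `longrange-wall-ghost-bootstrap` (objects
`clusterH`, `footAt` of `Theorems/PercLowPointHalfSpaceQuantitativeBGNWallDefs.lean`, namespace
`…Theorems.WallGhost`): for EVERY bulk density `p` and all `k m t` with `t ≥ 1`,

`P_p(|C_H(0) ∩ {x₀ < k}| ≥ t, F ≤ m) ≤ m k / t`,

where `U = C_H(0)` is the open cluster of the origin inside `H = {x₀ ≥ 0}` and
`F = footAt ω 0 = |U ∩ {x₀ = 0}| ≥ 1` its wall footprint. The bound is `p`-blind (no criticality, no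
finiteness of `U` is used):

* **wall mass transport at the height of a site `x`**
  (`ThinFootSlabVolume.lintegral_level_mul_inv_le_one`): the transport
  `f(u,v) = E_p[1{v + x ∈ C_H(u)} · 1{F_u ≤ m} / F_u]` between wall vertices `u, v` is diagonally invariant
  under the wall translations (`WallTwoGhost.add_mem_clusterH_shiftConfig_iff`, `footAt_shiftConfig`,
  `TwoGhost.lintegral_shiftConfig`), so `WallTwoGhost.wall_mtp` gives
  `E_p[N_x · 1{F ≤ m} / F] = E_p[in-mass of 0] ≤ 1`, `N_x = |U ∩ {v₀ = x₀}|`: the wall vertices sending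
  mass to `0` are the wall points of `C_H(x)`, each sending `1{F(C_H(x)) ≤ m} / F(C_H(x))`;
* hence `E_p[N_x ; F ≤ m] ≤ m` (`F ≥ 1`), the slab count `|U ∩ {x₀ < k}|` is at most the sum of the `k`
  level counts (`encard_slab_le`, `U ⊆ H`), so `E_p[|U ∩ {x₀ < k}| ; F ≤ m] ≤ m k`
  (`lintegral_slab_le`), and Markov's inequality concludes (`stub_thinFootSlabVolume`).
-/

noncomputable section

namespace Summit.CriticalPhenomena.PercolationContinuityZ3.Theorems

open MeasureTheory Literature.Probability.Percolation Literature.Probability.LatticeModels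
open Summit.CriticalPhenomena.PercolationContinuityZ3.Theorems.WallGhost
open scoped ENNReal

namespace ThinFootSlabVolume

open WallTwoGhost

/-! ### Footprints: lower bound, wall-shift covariance, measurability -/

/-- A wall vertex has footprint `≥ 1` (it lies in its own `H`-cluster). [folklore] -/
theorem one_le_footAt {x : Site 3} (hx : x 0 = 0) (ω : BondConfig (Site 3)) : 1 ≤ footAt ω x := by
  unfold footAt
  rw [Set.one_le_encard_iff_nonempty]
  exact ⟨x, self_mem_clusterH hx.symm.le ω, hx⟩

/-- Wall translations preserve the (extended) footprint: `F^{ω+t}(x + t) = F^ω(x)` (`x ∈ H`, `t ∈ ∂H`).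
[folklore] -/
theorem footAt_shiftConfig {t : Site 3} (ht : t 0 = 0) {x : Site 3} (hx : 0 ≤ x 0)
    (ω : BondConfig (Site 3)) : footAt (TwoGhost.shiftConfig t ω) (x + t) = footAt ω x := by
  have hW : (· + t) '' ({v : Site 3 | v 0 = 0}) = {v | v 0 = 0} := by
    ext v
    constructor
    · rintro ⟨w, hw, rfl⟩; simpa [ht] using hw
    · intro hv; exact ⟨v - t, by simpa [ht] using hv, by simp⟩
  unfold footAt
  rw [clusterH_shiftConfig ht hx]
  conv_lhs => rw [← hW, ← Set.image_inter (add_left_injective t), (add_left_injective t).encard_image]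

/-- `ω ↦ |C_H(0) ∩ S| ∈ ℝ≥0∞` is measurable for every set of sites `S`. [folklore] -/
theorem measurable_encard_inter (S : Set (Site 3)) :
    Measurable fun ω : BondConfig (Site 3) => (((clusterH ω 0 ∩ S).encard : ℕ∞) : ℝ≥0∞) := by
  refine (Measurable.of_discrete (f := fun n : ℕ∞ => (n : ℝ≥0∞))).comp
    (measurable_encard.comp (measurable_set_iff.2 fun v => ?_))
  exact (measurable_set_iff.1 (WallBootstrap.measurable_clusterH 0) v).and measurable_const

/-- The thin-foot event `{F_x ≤ m}` is measurable. [folklore] -/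
theorem measurableSet_footAt_le (x : Site 3) (m : ℕ) :
    MeasurableSet {ω : BondConfig (Site 3) | footAt ω x ≤ (m : ℕ∞)} :=
  WallBootstrap.measurable_footAt x (MeasurableSet.of_discrete (s := Set.Iic (m : ℕ∞)))

/-! ### The wall mass transport at a fixed height -/

open Classical in
/-- **Wall mass transport at the height of a site `x`.** For every `p`, `x` and `m`,
`E_p[|C_H(0) ∩ {v₀ = x₀}| · 1{F ≤ m} / F] ≤ 1` (trivially so when `x₀ < 0`): the transport
`f(u,v) = E_p[1{v + x ∈ C_H(u)} 1{F_u ≤ m} / F_u]` between wall vertices is diagonally invariant under wall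
translations, its out-mass at `0` is the integrand, and its in-mass at `0` is
`|C_H(x) ∩ ∂H| · 1{F(C_H(x)) ≤ m} / F(C_H(x)) ≤ 1` (all wall senders lie in `C_H(x)`); conclude with
`WallTwoGhost.wall_mtp` and Tonelli. [folklore] -/
theorem lintegral_level_mul_inv_le_one (p : unitInterval) (x : Site 3) (m : ℕ) :
    ∫⁻ ω, (((clusterH ω 0 ∩ {v : Site 3 | v 0 = x 0}).encard : ℕ∞) : ℝ≥0∞) *
        {ω : BondConfig (Site 3) | footAt ω 0 ≤ (m : ℕ∞)}.indicator
          (fun ω => (((footAt ω 0 : ℕ∞) : ℝ≥0∞))⁻¹) ω ∂(bondPercolation (zdGraph 3) p) ≤ 1 := by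
  set P := bondPercolation (zdGraph 3) p with hP
  -- the transport (pointwise in `ω`)
  set φ : BondConfig (Site 3) → Site 3 → Site 3 → ℝ≥0∞ := fun ω u v =>
    if u 0 = 0 ∧ v 0 = 0 ∧ v + x ∈ clusterH ω u ∧ footAt ω u ≤ (m : ℕ∞) then
      (((footAt ω u : ℕ∞) : ℝ≥0∞))⁻¹ else 0 with hφ
  -- (1) mass sent by `0`
  have hsent : ∀ ω, ∑' v, φ ω 0 v =
      (((clusterH ω 0 ∩ {v : Site 3 | v 0 = x 0}).encard : ℕ∞) : ℝ≥0∞) *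
        {ω : BondConfig (Site 3) | footAt ω 0 ≤ (m : ℕ∞)}.indicator
          (fun ω => (((footAt ω 0 : ℕ∞) : ℝ≥0∞))⁻¹) ω := by
    intro ω
    by_cases hF : footAt ω 0 ≤ (m : ℕ∞)
    · rw [Set.indicator_of_mem (show ω ∈ {ω : BondConfig (Site 3) | footAt ω 0 ≤ (m : ℕ∞)} from hF)]
      set B : Set (Site 3) := {v | v 0 = 0 ∧ v + x ∈ clusterH ω 0} with hB
      have hterm : ∀ v, φ ω 0 v = B.indicator (fun _ => (((footAt ω 0 : ℕ∞) : ℝ≥0∞))⁻¹) v := by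
        intro v
        by_cases hv : v ∈ B
        · rw [Set.indicator_of_mem hv]
          simp only [hφ]
          rw [if_pos ⟨rfl, hv.1, hv.2, hF⟩]
        · rw [Set.indicator_of_notMem hv]
          simp only [hφ]
          rw [if_neg (fun h => hv ⟨h.2.1, h.2.2.1⟩)]
      have hBeq : B = (· + x) ⁻¹' (clusterH ω 0 ∩ {v : Site 3 | v 0 = x 0}) := by
        ext v
        simp only [hB, Set.mem_setOf_eq, Set.mem_preimage, Set.mem_inter_iff, Pi.add_apply]
        constructor
        · rintro ⟨hv0, hvx⟩
          exact ⟨hvx, by rw [hv0, zero_add]⟩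
        · rintro ⟨hvx, hv0⟩
          exact ⟨by omega, hvx⟩
      have hcard : B.encard = (clusterH ω 0 ∩ {v : Site 3 | v 0 = x 0}).encard := by
        rw [hBeq]
        exact Set.encard_preimage_of_bijective ⟨add_left_injective x, add_right_surjective x⟩ _
      rw [tsum_congr hterm, ← tsum_subtype, ENNReal.tsum_set_const, hcard]
    · rw [Set.indicator_of_notMem (show ω ∉ {ω : BondConfig (Site 3) | footAt ω 0 ≤ (m : ℕ∞)} from hF),
        mul_zero]
      refine ENNReal.tsum_eq_zero.2 fun v => ?_
      simp only [hφ]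
      rw [if_neg (fun h => hF h.2.2.2)]
  -- (2) mass received by `0`
  have hrecv : ∀ ω, ∑' u, φ ω u 0 ≤ 1 := by
    intro ω
    set B : Set (Site 3) := {u | u 0 = 0 ∧ x ∈ clusterH ω u ∧ footAt ω u ≤ (m : ℕ∞)} with hB
    have hKu : ∀ u ∈ B, clusterH ω u = clusterH ω x := fun u hu => (clusterH_eq_of_mem hu.2.1).symm
    have hFu : ∀ u ∈ B, footAt ω u = footAt ω x := fun u hu => by unfold footAt; rw [hKu u hu]
    have hterm : ∀ u, φ ω u 0 = B.indicator (fun _ => (((footAt ω x : ℕ∞) : ℝ≥0∞))⁻¹) u := by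
      intro u
      by_cases hu : u ∈ B
      · rw [Set.indicator_of_mem hu, ← hFu u hu]
        simp only [hφ]
        rw [if_pos ⟨hu.1, rfl, by rw [zero_add]; exact hu.2.1, hu.2.2⟩]
      · rw [Set.indicator_of_notMem hu]
        simp only [hφ]
        rw [if_neg (fun h => hu ⟨h.1, by rw [← zero_add x]; exact h.2.2.1, h.2.2.2⟩)]
    rw [tsum_congr hterm, ← tsum_subtype, ENNReal.tsum_set_const]
    have hBsub : B ⊆ clusterH ω x ∩ {v : Site 3 | v 0 = 0} := fun u hu => ⟨mem_clusterH_comm.2 hu.2.1, hu.1⟩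
    have hle : ((B.encard : ℕ∞) : ℝ≥0∞) ≤ ((footAt ω x : ℕ∞) : ℝ≥0∞) :=
      ENat.toENNReal_le.2 (Set.encard_le_encard hBsub)
    calc ((B.encard : ℕ∞) : ℝ≥0∞) * (((footAt ω x : ℕ∞) : ℝ≥0∞))⁻¹
        ≤ ((footAt ω x : ℕ∞) : ℝ≥0∞) * (((footAt ω x : ℕ∞) : ℝ≥0∞))⁻¹ := mul_le_mul' hle le_rfl
      _ ≤ 1 := ENNReal.mul_inv_le_one _
  -- (3) diagonal invariance under wall translations
  have hcov : ∀ t : Site 3, t 0 = 0 → ∀ (ω : BondConfig (Site 3)) (u v : Site 3),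
      φ (TwoGhost.shiftConfig t ω) (u + t) (v + t) = φ ω u v := by
    intro t ht ω u v
    simp only [hφ]
    by_cases hu : u 0 = 0
    · have hu' : (u + t) 0 = 0 := by simp [hu, ht]
      have huH : 0 ≤ u 0 := hu.symm.le
      have hv' : (v + t) 0 = 0 ↔ v 0 = 0 := by simp [ht]
      have hmem : v + t + x ∈ clusterH (TwoGhost.shiftConfig t ω) (u + t) ↔ v + x ∈ clusterH ω u := by
        rw [add_right_comm]
        exact add_mem_clusterH_shiftConfig_iff ht huH ω (v + x)
      have hfoot : footAt (TwoGhost.shiftConfig t ω) (u + t) = footAt ω u := footAt_shiftConfig ht huH ω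
      rw [hfoot]
      by_cases h : u 0 = 0 ∧ v 0 = 0 ∧ v + x ∈ clusterH ω u ∧ footAt ω u ≤ (m : ℕ∞)
      · rw [if_pos h, if_pos ⟨hu', hv'.2 h.2.1, hmem.2 h.2.2.1, h.2.2.2⟩]
      · rw [if_neg h, if_neg (fun h' => h ⟨hu, hv'.1 h'.2.1, hmem.1 h'.2.2.1, h'.2.2.2⟩)]
    · have hu' : ¬ (u + t) 0 = 0 := by simp [ht, hu]
      simp only [hu, hu', false_and, if_false]
  -- (4) measurability
  have hmeasφ : ∀ u v, Measurable fun ω => φ ω u v := by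
    intro u v
    simp only [hφ]
    refine Measurable.ite ?_ ?_ measurable_const
    · exact (MeasurableSet.const _).inter ((MeasurableSet.const _).inter
        ((measurableSet_mem_clusterH u (v + x)).inter (measurableSet_footAt_le u m)))
    · exact ((Measurable.of_discrete (f := fun n : ℕ∞ => (n : ℝ≥0∞))).comp
        (WallBootstrap.measurable_footAt u)).inv
  -- (5) the transport principle for `Γ u v = E[φ u v]`
  set Γ : Site 3 → Site 3 → ℝ≥0∞ := fun u v => ∫⁻ ω, φ ω u v ∂P with hΓ
  have h0 : ∀ u v, v 0 ≠ 0 → Γ u v = 0 := by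
    intro u v hv
    simp only [hΓ]
    refine (lintegral_eq_zero_iff (hmeasφ u v)).2 (Filter.Eventually.of_forall fun ω => ?_)
    simp only [hφ, Pi.zero_apply]
    rw [if_neg (fun h => hv h.2.1)]
  have h1 : ∀ u v, u 0 ≠ 0 → Γ u v = 0 := by
    intro u v hu
    simp only [hΓ]
    refine (lintegral_eq_zero_iff (hmeasφ u v)).2 (Filter.Eventually.of_forall fun ω => ?_)
    simp only [hφ, Pi.zero_apply]
    rw [if_neg (fun h => hu h.1)]
  have hinv : ∀ t : Site 3, t 0 = 0 → ∀ u v, Γ (u + t) (v + t) = Γ u v := by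
    intro t ht u v
    simp only [hΓ]
    rw [← TwoGhost.lintegral_shiftConfig t p (fun ω => φ ω (u + t) (v + t))]
    exact lintegral_congr fun ω => hcov t ht ω u v
  have hmtp := wall_mtp Γ h0 h1 hinv
  calc ∫⁻ ω, (((clusterH ω 0 ∩ {v : Site 3 | v 0 = x 0}).encard : ℕ∞) : ℝ≥0∞) *
          {ω : BondConfig (Site 3) | footAt ω 0 ≤ (m : ℕ∞)}.indicator
            (fun ω => (((footAt ω 0 : ℕ∞) : ℝ≥0∞))⁻¹) ω ∂P
      = ∫⁻ ω, ∑' v, φ ω 0 v ∂P := lintegral_congr fun ω => (hsent ω).symm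
    _ = ∑' v, Γ 0 v := lintegral_tsum fun v => (hmeasφ 0 v).aemeasurable
    _ = ∑' u, Γ u 0 := hmtp
    _ = ∫⁻ ω, ∑' u, φ ω u 0 ∂P := (lintegral_tsum fun u => (hmeasφ u 0).aemeasurable).symm
    _ ≤ ∫⁻ _, 1 ∂P := lintegral_mono fun ω => hrecv ω
    _ = 1 := by rw [lintegral_const, measure_univ, mul_one]

/-- **Expected level count on the thin-foot event**: `E_p[|C_H(0) ∩ {v₀ = x₀}| ; F ≤ m] ≤ m` for every site
`x` (on `{F ≤ m}` one has `1 ≤ m / F` since `F ≥ 1`). [folklore] -/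
theorem lintegral_level_le (p : unitInterval) (x : Site 3) (m : ℕ) :
    ∫⁻ ω, {ω : BondConfig (Site 3) | footAt ω 0 ≤ (m : ℕ∞)}.indicator
        (fun ω => (((clusterH ω 0 ∩ {v : Site 3 | v 0 = x 0}).encard : ℕ∞) : ℝ≥0∞)) ω
      ∂(bondPercolation (zdGraph 3) p) ≤ m := by
  set P := bondPercolation (zdGraph 3) p with hP
  have hpt : ∀ ω, {ω : BondConfig (Site 3) | footAt ω 0 ≤ (m : ℕ∞)}.indicator
      (fun ω => (((clusterH ω 0 ∩ {v : Site 3 | v 0 = x 0}).encard : ℕ∞) : ℝ≥0∞)) ω ≤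
      (m : ℝ≥0∞) * ((((clusterH ω 0 ∩ {v : Site 3 | v 0 = x 0}).encard : ℕ∞) : ℝ≥0∞) *
        {ω : BondConfig (Site 3) | footAt ω 0 ≤ (m : ℕ∞)}.indicator
          (fun ω => (((footAt ω 0 : ℕ∞) : ℝ≥0∞))⁻¹) ω) := by
    intro ω
    by_cases hF : footAt ω 0 ≤ (m : ℕ∞)
    · rw [Set.indicator_of_mem (show ω ∈ {ω : BondConfig (Site 3) | footAt ω 0 ≤ (m : ℕ∞)} from hF),
        Set.indicator_of_mem (show ω ∈ {ω : BondConfig (Site 3) | footAt ω 0 ≤ (m : ℕ∞)} from hF)]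
      set N : ℝ≥0∞ := (((clusterH ω 0 ∩ {v : Site 3 | v 0 = x 0}).encard : ℕ∞) : ℝ≥0∞) with hN
      have hF0 : ((footAt ω 0 : ℕ∞) : ℝ≥0∞) ≠ 0 := by
        rw [Ne, ENat.toENNReal_eq_zero]
        exact (zero_lt_one.trans_le (one_le_footAt rfl ω)).ne'
      have hFm : ((footAt ω 0 : ℕ∞) : ℝ≥0∞) ≤ (m : ℝ≥0∞) := by
        rw [← ENat.toENNReal_coe]; exact ENat.toENNReal_le.2 hF
      have h1 : (1 : ℝ≥0∞) ≤ (m : ℝ≥0∞) * (((footAt ω 0 : ℕ∞) : ℝ≥0∞))⁻¹ := by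
        rw [← div_eq_mul_inv, ENNReal.le_div_iff_mul_le (Or.inl hF0) (Or.inr (ENNReal.natCast_ne_top m)),
          one_mul]
        exact hFm
      calc N = N * 1 := (mul_one N).symm
        _ ≤ N * ((m : ℝ≥0∞) * (((footAt ω 0 : ℕ∞) : ℝ≥0∞))⁻¹) := mul_le_mul' le_rfl h1
        _ = (m : ℝ≥0∞) * (N * (((footAt ω 0 : ℕ∞) : ℝ≥0∞))⁻¹) := mul_left_comm _ _ _
    · rw [Set.indicator_of_notMem (show ω ∉ {ω : BondConfig (Site 3) | footAt ω 0 ≤ (m : ℕ∞)} from hF)]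
      exact zero_le
  calc ∫⁻ ω, {ω : BondConfig (Site 3) | footAt ω 0 ≤ (m : ℕ∞)}.indicator
          (fun ω => (((clusterH ω 0 ∩ {v : Site 3 | v 0 = x 0}).encard : ℕ∞) : ℝ≥0∞)) ω ∂P
      ≤ ∫⁻ ω, (m : ℝ≥0∞) * ((((clusterH ω 0 ∩ {v : Site 3 | v 0 = x 0}).encard : ℕ∞) : ℝ≥0∞) *
          {ω : BondConfig (Site 3) | footAt ω 0 ≤ (m : ℕ∞)}.indicator
            (fun ω => (((footAt ω 0 : ℕ∞) : ℝ≥0∞))⁻¹) ω) ∂P := lintegral_mono hpt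
    _ = (m : ℝ≥0∞) * ∫⁻ ω, (((clusterH ω 0 ∩ {v : Site 3 | v 0 = x 0}).encard : ℕ∞) : ℝ≥0∞) *
          {ω : BondConfig (Site 3) | footAt ω 0 ≤ (m : ℕ∞)}.indicator
            (fun ω => (((footAt ω 0 : ℕ∞) : ℝ≥0∞))⁻¹) ω ∂P :=
        lintegral_const_mul' _ _ (ENNReal.natCast_ne_top m)
    _ ≤ (m : ℝ≥0∞) * 1 := mul_le_mul' le_rfl (lintegral_level_mul_inv_le_one p x m)
    _ = m := mul_one _

/-! ### From levels to the slab, and Markov -/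

/-- **Slab count ≤ sum of level counts**: `|C_H(0) ∩ {x₀ < k}| ≤ Σ_{h<k} |C_H(0) ∩ {x₀ = h}|`
(`C_H(0) ⊆ H`). [folklore] -/
theorem encard_slab_le (ω : BondConfig (Site 3)) (k : ℕ) :
    (((clusterH ω 0 ∩ {v : Site 3 | v 0 < (k : ℤ)}).encard : ℕ∞) : ℝ≥0∞) ≤
      ∑ h ∈ Finset.range k, (((clusterH ω 0 ∩ {v : Site 3 | v 0 = (h : ℤ)}).encard : ℕ∞) : ℝ≥0∞) := by
  induction k with
  | zero =>
    have : clusterH ω 0 ∩ {v : Site 3 | v 0 < ((0 : ℕ) : ℤ)} = ∅ := by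
      ext v
      simp only [Set.mem_inter_iff, Set.mem_setOf_eq, Set.mem_empty_iff_false, iff_false, not_and, not_lt,
        Nat.cast_zero]
      exact fun hv => nonneg_of_mem_clusterH hv
    rw [this, Set.encard_empty]
    simp
  | succ k ih =>
    have hset : clusterH ω 0 ∩ {v : Site 3 | v 0 < ((k + 1 : ℕ) : ℤ)} =
        (clusterH ω 0 ∩ {v : Site 3 | v 0 < (k : ℤ)}) ∪ (clusterH ω 0 ∩ {v : Site 3 | v 0 = (k : ℤ)}) := by
      ext v
      simp only [Set.mem_inter_iff, Set.mem_setOf_eq, Set.mem_union, Nat.cast_succ]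
      constructor
      · rintro ⟨hv, hlt⟩
        rcases lt_or_eq_of_le (Int.lt_add_one_iff.1 hlt) with h | h
        · exact Or.inl ⟨hv, h⟩
        · exact Or.inr ⟨hv, h⟩
      · rintro (⟨hv, h⟩ | ⟨hv, h⟩)
        · exact ⟨hv, by omega⟩
        · exact ⟨hv, by omega⟩
    rw [hset, Finset.sum_range_succ]
    calc ((((clusterH ω 0 ∩ {v : Site 3 | v 0 < (k : ℤ)}) ∪
            (clusterH ω 0 ∩ {v : Site 3 | v 0 = (k : ℤ)})).encard : ℕ∞) : ℝ≥0∞)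
        ≤ (((clusterH ω 0 ∩ {v : Site 3 | v 0 < (k : ℤ)}).encard +
            (clusterH ω 0 ∩ {v : Site 3 | v 0 = (k : ℤ)}).encard : ℕ∞) : ℝ≥0∞) :=
          ENat.toENNReal_le.2 (Set.encard_union_le _ _)
      _ = (((clusterH ω 0 ∩ {v : Site 3 | v 0 < (k : ℤ)}).encard : ℕ∞) : ℝ≥0∞) +
            (((clusterH ω 0 ∩ {v : Site 3 | v 0 = (k : ℤ)}).encard : ℕ∞) : ℝ≥0∞) := ENat.toENNReal_add _ _
      _ ≤ _ := add_le_add ih le_rfl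

/-- **Expected slab count on the thin-foot event**: `E_p[|C_H(0) ∩ {x₀ < k}| ; F ≤ m] ≤ m k`. [folklore] -/
theorem lintegral_slab_le (p : unitInterval) (k m : ℕ) :
    ∫⁻ ω, {ω : BondConfig (Site 3) | footAt ω 0 ≤ (m : ℕ∞)}.indicator
        (fun ω => (((clusterH ω 0 ∩ {v : Site 3 | v 0 < (k : ℤ)}).encard : ℕ∞) : ℝ≥0∞)) ω
      ∂(bondPercolation (zdGraph 3) p) ≤ (m : ℝ≥0∞) * k := by
  set P := bondPercolation (zdGraph 3) p with hP
  set T : Set (BondConfig (Site 3)) := {ω | footAt ω 0 ≤ (m : ℕ∞)} with hT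
  have hpt : ∀ ω, T.indicator
      (fun ω => (((clusterH ω 0 ∩ {v : Site 3 | v 0 < (k : ℤ)}).encard : ℕ∞) : ℝ≥0∞)) ω ≤
      ∑ h ∈ Finset.range k, T.indicator
        (fun ω => (((clusterH ω 0 ∩ {v : Site 3 | v 0 = (h : ℤ)}).encard : ℕ∞) : ℝ≥0∞)) ω := by
    intro ω
    by_cases hF : ω ∈ T
    · simp only [Set.indicator_of_mem hF]
      exact encard_slab_le ω k
    · simp only [Set.indicator_of_notMem hF, Finset.sum_const_zero]
      exact le_rfl
  have hmeas : ∀ h : ℕ, Measurable fun ω => T.indicator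
      (fun ω => (((clusterH ω 0 ∩ {v : Site 3 | v 0 = (h : ℤ)}).encard : ℕ∞) : ℝ≥0∞)) ω :=
    fun h => (measurable_encard_inter _).indicator (measurableSet_footAt_le 0 m)
  have hlev : ∀ h : ℕ, ∫⁻ ω, T.indicator
      (fun ω => (((clusterH ω 0 ∩ {v : Site 3 | v 0 = (h : ℤ)}).encard : ℕ∞) : ℝ≥0∞)) ω ∂P ≤ m := by
    intro h
    have h0 : (Pi.single 0 (h : ℤ) : Site 3) 0 = (h : ℤ) := by simp
    have := lintegral_level_le p (Pi.single 0 (h : ℤ) : Site 3) m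
    simpa only [h0] using this
  calc ∫⁻ ω, T.indicator
          (fun ω => (((clusterH ω 0 ∩ {v : Site 3 | v 0 < (k : ℤ)}).encard : ℕ∞) : ℝ≥0∞)) ω ∂P
      ≤ ∫⁻ ω, ∑ h ∈ Finset.range k, T.indicator
          (fun ω => (((clusterH ω 0 ∩ {v : Site 3 | v 0 = (h : ℤ)}).encard : ℕ∞) : ℝ≥0∞)) ω ∂P :=
        lintegral_mono hpt
    _ = ∑ h ∈ Finset.range k, ∫⁻ ω, T.indicator
          (fun ω => (((clusterH ω 0 ∩ {v : Site 3 | v 0 = (h : ℤ)}).encard : ℕ∞) : ℝ≥0∞)) ω ∂P :=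
        lintegral_finsetSum _ fun h _ => hmeas h
    _ ≤ ∑ _h ∈ Finset.range k, (m : ℝ≥0∞) := Finset.sum_le_sum fun h _ => hlev h
    _ = (m : ℝ≥0∞) * k := by rw [Finset.sum_const, Finset.card_range, nsmul_eq_mul, mul_comm]

end ThinFootSlabVolume

open ThinFootSlabVolume in
/-- **Thin-footed clusters have small slab volume** (stub `stub_thinFootSlabVolume` of the line
`longrange-wall-ghost-bootstrap`, crux `QuantitativeBGN`): for EVERY bulk density `p` and all `k m t` with
`t ≥ 1`, `P_p(|C_H(0) ∩ {x₀ < k}| ≥ t ∧ F ≤ m) ≤ m k / t`, where `C_H(0)` is the open cluster of the origin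
inside `H = {x₀ ≥ 0}` and `F = |C_H(0) ∩ {x₀ = 0}|` its wall footprint. Proof: the wall mass transport
`E_p[N_h 1{F ≤ m}/F] ≤ 1` at each height `h < k` (`ThinFootSlabVolume.lintegral_level_mul_inv_le_one`),
`F ≥ 1`, summation over the `k` levels and Markov's inequality. [folklore] -/
theorem stub_thinFootSlabVolume : ∀ p : unitInterval, ∀ k m t : ℕ, 1 ≤ t → (bondPercolation (zdGraph 3) p).real ({ω | (t : ℕ∞) ≤ (clusterH ω 0 ∩ {v : Site 3 | v 0 < (k : ℤ)}).encard} ∩ {ω | footAt ω 0 ≤ (m : ℕ∞)}) ≤ (m : ℝ) * k / t := by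
  intro p k m t ht
  set P := bondPercolation (zdGraph 3) p with hP
  set E : Set (BondConfig (Site 3)) :=
    {ω | (t : ℕ∞) ≤ (clusterH ω 0 ∩ {v : Site 3 | v 0 < (k : ℤ)}).encard} ∩ {ω | footAt ω 0 ≤ (m : ℕ∞)}
    with hE
  set Φ : BondConfig (Site 3) → ℝ≥0∞ := fun ω => {ω : BondConfig (Site 3) | footAt ω 0 ≤ (m : ℕ∞)}.indicator
    (fun ω => (((clusterH ω 0 ∩ {v : Site 3 | v 0 < (k : ℤ)}).encard : ℕ∞) : ℝ≥0∞)) ω with hΦ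
  have hΦm : Measurable Φ := (measurable_encard_inter _).indicator (measurableSet_footAt_le 0 m)
  have hsub : E ⊆ {ω | (t : ℝ≥0∞) ≤ Φ ω} := by
    rintro ω ⟨h1, h2⟩
    show (t : ℝ≥0∞) ≤ Φ ω
    simp only [hΦ]
    rw [Set.indicator_of_mem (show ω ∈ {ω : BondConfig (Site 3) | footAt ω 0 ≤ (m : ℕ∞)} from h2),
      ← ENat.toENNReal_coe]
    exact ENat.toENNReal_le.2 h1
  have hmarkov : (t : ℝ≥0∞) * P E ≤ (m : ℝ≥0∞) * k :=
    calc (t : ℝ≥0∞) * P E ≤ (t : ℝ≥0∞) * P {ω | (t : ℝ≥0∞) ≤ Φ ω} := by gcongr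
      _ ≤ ∫⁻ ω, Φ ω ∂P := mul_meas_ge_le_lintegral hΦm _
      _ ≤ (m : ℝ≥0∞) * k := lintegral_slab_le p k m
  have ht0 : (t : ℝ≥0∞) ≠ 0 := by exact_mod_cast (show t ≠ 0 by omega)
  have hle : P E ≤ (m : ℝ≥0∞) * k / t := by
    rw [ENNReal.le_div_iff_mul_le (Or.inl ht0) (Or.inl (ENNReal.natCast_ne_top t)), mul_comm]
    exact hmarkov
  have hfin : (m : ℝ≥0∞) * k / t ≠ ⊤ :=
    ENNReal.div_ne_top (ENNReal.mul_ne_top (ENNReal.natCast_ne_top m) (ENNReal.natCast_ne_top k)) ht0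
  calc P.real E = (P E).toReal := measureReal_def _ _
    _ ≤ ((m : ℝ≥0∞) * k / t).toReal := ENNReal.toReal_mono hfin hle
    _ = (m : ℝ) * k / t := by
        rw [ENNReal.toReal_div, ENNReal.toReal_mul, ENNReal.toReal_natCast, ENNReal.toReal_natCast,
          ENNReal.toReal_natCast]

end Summit.CriticalPhenomena.PercolationContinuityZ3.Theorems

end
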